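/- Copyright: the b2b-balaban cell (near-miss cell 7), T⁴-continuum fan-out; row NE7b CRUX team (2), OWNER seat
t4-ne7b-p1 (gen 54) — INTERFACE REQUEST NE7b IR-54-1 «(α)-JOINT», item (J1) of 3: the joint LETTERS.  Released under the
licence of the surrounding project. -/
import Summits.QuantumFields.BalabanUV.T4Continuum.Support.HistoryRealiseCellsRunAssemblyWTVSLWLP82

/-!
# (α)-JOINT, part 1: ONE TUPLE OF LETTERS MEETING EVERY LETTER-LEVEL BINDER OF THE TERMINAL THEOREM OF RECORD AND OF ITS
RECORD AT ONCE (INTERFACE REQUEST NE7b IR-54-1 (J1); owner lineage `t4-ne7b-p1` gen 54)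

Summits-side support leaf of the T⁴-continuum cell (rung (B)+1 on a FINITE torus only; NOT infinite volume, NOT the
mass gap, NOT Clay; NOT a proof of NE7b — the cell's OWN estimate, NOT PRINTED, NOT PROVED).  [decided arithmetic]
Two `def`s (symbolic constants `Cj`, `Lj`) and decided (in)equalities between them; nothing printed asserted, no
`def … : Prop` fact, no cite-tagged hypothesis, zero `sorry`.

WHY (owner item (α)-JOINT, journal `CLAIMS.log` l.36187, `HOME/INBOX.md` IR-54-1).  The terminal theorem of record
`HistoryRealiseCellsRunAssemblyWTVSLWLP82.continuumYM4Torus_of_histReadingLWL_fsc` (p303949) conjoins the record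
`HistReadDataLWL` (under `ForSmallCouplings`) with some thirty binders OUTSIDE it.  Every inhabitation on file is of the
RECORD ALONE (leaf-05 parts 3∕15∕16, on `toyData`, at `C₄ = ⟨13, 0, 3, 1, 1, 0, 0, 0, 0, 0, 1, 3⟩`), and the toy constants
provably do NOT meet the outside binders: `CountThresholdUniform.ThresholdOK.rq_lt : rr·(q′+1) < p₀` reads `4 < 3`,
`0 < C.μ` and `hκ₁ : d·log L + 2·log 2 ≤ C.κ₁` fail at `C₄.μ = C₄.κ₁ = 0` (`not_thresholdOK_C₄`, `not_joint_C₄` below).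
So the JOINT satisfiability of the letter-level part of the terminal antecedent — the record's census rows
`hexpR ∕ hexpR′ ∕ hexpB ∕ hexpFL ∕ hdq ∕ hexpVL`, its gaps and sign letters, TOGETHER WITH `ThresholdOK`, `0 < μ`, `hκ₁`,
`hE₀`, `hA₀`, `hβ₀`, `hLβ`, `hn₁`, `hslack`, `hE₂`, `hE₃`, `hsS`, `hsmall`, `hθc0 ∕ hθc1 ∕ hθcs` — was undecided on the
tree.  THIS FILE decides it POSITIVELY with one explicit tuple.

WHAT.  §1 `Cj := ⟨13, 0, 3, 1, 1, Lj + 2, 2, 0, 1, 1∕2, 1, 5⟩` (`n₁ dC q′ E₂ E₃ κ₁ E₀ Eb μ a A₀ p₀`), `Lj := 87781` (odd,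
`> 11`: an admissible `T4Family.L`; the smallest odd `L` with `2·(2·cth 32 1 2 + 1)·5·66 ≤ L`, the `hsmall` row at
`d = 1`, `sS = 2`).  §2 the OUTSIDE binders at `(C, L, rr, d, sS, θc, β₀, θ, θv) = (Cj, Lj, 1, 1, 2, 3∕4, 1∕Lj, 1∕8, 1∕8)`
against `O₁` (`γ₀·A₁²∕2 = 1`): `thresholdOK_Cj`, `joint_outside_Cj` (eleven conjuncts, the terminal's binders verbatim).
§3 the RECORD's letter rows at the same `(Cj, O₁, rr = 1, d = 1)` with census letters `(p₁, η, η′, κ, κ₂, κᵥ) =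
(6, 3, 4, 6, 1, 8)` and `(cΛ, M, Lr, Φ, b₀, θv) = (0, 0, 0, 0, 1∕Lj, 1∕8)`: `joint_record_Cj` (the rows
`hn₁ hE₂ hE₃pos hp₀ hA₀ hγ₀ hA₁ hM hβd hθv hcΛ hMΛ hLr hΦ hβ₀ hexpR hexpR′ hexpB hexpFL hdq hexpVL hη hη′ hκ hκ₂ hκᵥ` of
`HistReadDataLWL` ∕ of leaf-05's constructor `histReadDataLWL₄`, verbatim).  §4 the negatives at `C₄` (located, decided).

HONEST.  Decided arithmetic over OUR letters; it certifies that the LETTER-LEVEL binders of the road of record are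
jointly satisfiable (at record dimension `d = 1`, as the toy; the physical lattice dimension is `Params.d = 4`
throughout and is not this letter) — NOT that any of them holds at print's constants, which are unvalued (ρ = cΛ∕c_{E₂}
UNVALUED).  Parts (J2) (the NE7-rate rows (2.5)∕(2.7)∕(2.9) on a running one-loop flow) and (J3) (a datum on which
(B) ∧ `BetaPertHyp` hold, and the terminal theorem applied) are separate files.  Nothing of Bałaban's is discharged;
every R-class row of the wall stays; NE7b NOT PRINTED ∕ NOT PROVED; spine 0∕9.  HONEST DEPENDENCY (cell): continuum YM
on T⁴ ⇐ BetaPertH ∧ nine spine estimates (0/9 proved); BetaPertH ⇐ (D1) ∧ (D4) ∧ CAP+tail; G-an2-4 gates asym, D1 and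
NE2/3/4.  Unchanged here.
-/

open Literature.MathematicalPhysics.QuantumFieldTheory.Balaban1983to89
open Summit.QuantumFields.BalabanUV.T4Continuum.CountThresholdUniform (ThresholdOK)
open Summit.QuantumFields.BalabanUV.T4Continuum.HistoryZoneEvolve (cth)
open Summit.QuantumFields.BalabanUV.T4Continuum.HistoryConstants (PrintedO1s)
open Summit.QuantumFields.BalabanUV.T4Continuum.HistoryConstants.Sanity (O₁)

namespace Summit.QuantumFields.BalabanUV.T4Continuum.HistoryRealiseCellsRunAssemblyWTVSJointLetters

noncomputable section

/-! ## §1 The letters -/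

/-- THE JOINT BLOCKING LETTER: `87781 = 2·(2·cth 32 1 2 + 1)·5·66 + 1`, odd and `> 11`. [decided arithmetic] -/
def Lj : ℕ := 87781

/-- `Lj` is an admissible `T4Family` blocking parameter: odd, `> 1`, `> 11`. [decided arithmetic] -/
theorem Lj_admissible : (Odd Lj ∧ 1 < Lj) ∧ 11 < Lj := by
  refine ⟨⟨⟨43890, by norm_num [Lj]⟩, by norm_num [Lj]⟩, by norm_num [Lj]⟩

/-- THE JOINT SYMBOLIC CONSTANTS `Cj = ⟨n₁, dC, q′, E₂, E₃, κ₁, E₀, Eb, μ, a, A₀, p₀⟩ := ⟨13, 0, 3, 1, 1, Lj + 2, 2, 0, 1, 1∕2,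
1, 5⟩` — the toy's `C₄` with `p₀ := 5` (so that `rr·(q′+1) = 4 < p₀`), `κ₁ := Lj + 2`, `E₀ := 2`, `μ := 1`, `a := 1∕2`.
[decided arithmetic] -/
def Cj : T4PrintedShapeBanking.Consts := ⟨13, 0, 3, 1, 1, (Lj : ℝ) + 2, 2, 0, 1, 1 / 2, 1, 5⟩

/-- the field `n₁` of `Cj` [decided arithmetic] -/
@[simp] theorem Cj_n₁ : Cj.n₁ = 13 := rfl
/-- the field `dC` of `Cj` [decided arithmetic] -/
@[simp] theorem Cj_dC : Cj.dC = 0 := rfl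
/-- the field `q'` of `Cj` [decided arithmetic] -/
@[simp] theorem Cj_q' : Cj.q' = 3 := rfl
/-- the field `E₂` of `Cj` [decided arithmetic] -/
@[simp] theorem Cj_E₂ : Cj.E₂ = 1 := rfl
/-- the field `E₃` of `Cj` [decided arithmetic] -/
@[simp] theorem Cj_E₃ : Cj.E₃ = 1 := rfl
/-- the field `κ₁` of `Cj` [decided arithmetic] -/
@[simp] theorem Cj_κ₁ : Cj.κ₁ = (Lj : ℝ) + 2 := rfl
/-- the field `E₀` of `Cj` [decided arithmetic] -/
@[simp] theorem Cj_E₀ : Cj.E₀ = 2 := rfl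
/-- the field `Eb` of `Cj` [decided arithmetic] -/
@[simp] theorem Cj_Eb : Cj.Eb = 0 := rfl
/-- the field `μ` of `Cj` [decided arithmetic] -/
@[simp] theorem Cj_μ : Cj.μ = 1 := rfl
/-- the field `a` of `Cj` [decided arithmetic] -/
@[simp] theorem Cj_a : Cj.a = 1 / 2 := rfl
/-- the field `A₀` of `Cj` [decided arithmetic] -/
@[simp] theorem Cj_A₀ : Cj.A₀ = 1 := rfl
/-- the field `p₀` of `Cj` [decided arithmetic] -/
@[simp] theorem Cj_p₀ : Cj.p₀ = 5 := rfl

/-- the thickening radius of two collapsed steps at `c = 32`, `L = 1` is `66` [decided arithmetic] -/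
theorem cth_32_1_2 : cth 32 1 2 = 66 := by decide

/-! ## §2 The OUTSIDE binders of the terminal theorem at `(Cj, Lj, rr = 1, β₀ = 1∕Lj)` -/

/-- `Cj` is valid (`T4PrintedShapeBanking.Consts.Valid`: signs, and `fatWait dC = 1 ≤ n₁ = 13`). [decided arithmetic] -/
theorem valid_Cj : Cj.Valid where
  E₂_nonneg := by norm_num
  E₃_nonneg := by norm_num
  κ₁_nonneg := by simp only [Cj_κ₁]; positivity
  E₀_nonneg := by norm_num
  Eb_nonneg := le_rfl
  μ_nonneg := by norm_num
  dC_le := by simp [T4PersistenceDictionary.fatWait]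

/-- **`ThresholdOK Cj Lj 1 (1∕Lj)`** — the terminal's first outside binder (`rq_lt : 1·(3+1) < 5`). [decided arithmetic] -/
theorem thresholdOK_Cj : ThresholdOK Cj Lj 1 (1 / Lj) where
  valid := valid_Cj
  a_pos := by norm_num
  A₀_pos := by norm_num
  one_le_L := by norm_num [Lj]
  β₀_nonneg := by positivity
  rq_lt := by decide

/-- `T4CanonicalMenus.birthMass Cj ≤ 1`: `e⁰ · e⁻¹∕(1 − e⁻¹) ≤ 1` since `e⁻¹ ≤ 1∕2`. [decided arithmetic] -/
theorem birthMass_Cj_le_one : T4CanonicalMenus.birthMass Cj ≤ 1 := by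
  have he : Real.exp (-1) ≤ 1 / 2 := by
    have h2 : (2 : ℝ) ≤ Real.exp 1 := by
      have := Real.add_one_le_exp (1 : ℝ); linarith
    rw [Real.exp_neg]
    rw [inv_le_comm₀ (Real.exp_pos 1) (by norm_num)]
    simpa using h2
  have hpos : 0 < 1 - Real.exp (-1) := by linarith
  simp only [T4CanonicalMenus.birthMass, Cj_Eb, Cj_μ, neg_zero, Real.exp_zero, one_mul]
  rw [div_le_one hpos]
  linarith

/-- `0 ≤ T4CanonicalMenus.birthMass Cj`. [decided arithmetic] -/
theorem birthMass_Cj_nonneg : 0 ≤ T4CanonicalMenus.birthMass Cj := by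
  have he : Real.exp (-1) < 1 := by
    rw [Real.exp_lt_one_iff]; norm_num
  simp only [T4CanonicalMenus.birthMass, Cj_Eb, Cj_μ, neg_zero, Real.exp_zero, one_mul]
  exact div_nonneg (Real.exp_pos _).le (by linarith)

/-- **THE ELEVEN OUTSIDE LETTER BINDERS OF `continuumYM4Torus_of_histReadingLWL_fsc`, JOINTLY**, at `C := Cj`, `F.L := Lj`,
`rr := 1`, `β₀ := 1∕Lj`, `d := 1`, `n := 1`, `θ := θv := 1∕8`, `O := O₁`, `sS := 2`, `θc := 3∕4` — in the terminal's order: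
`hμ`, `hκ₁`, `hE₀`, `hA₀`, `hβ₀`, `hLβ`, `hn₁`, `hn`, `hθ`, `hslack`, `hE₂`, `hE₃`, `hsS`, `hsmall`, `hθc0`, `hθc1`, `hθcs`
(`ThresholdOK` is `thresholdOK_Cj`). [decided arithmetic] -/
theorem joint_outside_Cj :
    0 < Cj.μ ∧
    ((1 : ℕ) : ℝ) * Real.log (Lj : ℕ) + 2 * Real.log 2 ≤ Cj.κ₁ ∧
    Real.log (2 + T4CanonicalMenus.birthMass Cj) ≤ Cj.E₀ ∧
    1 ≤ Cj.A₀ ∧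
    (0 : ℝ) < 1 / Lj ∧ ((Lj : ℕ) : ℝ) * (1 / Lj) ≤ 1 ∧
    13 ≤ Cj.n₁ ∧ (0 : ℕ) < 1 ∧
    (0 : ℝ) < 1 / 8 ∧ Cj.a + (1 / 8 + 1 / 8) ≤ O₁.γ₀ * O₁.A₁ ^ 2 / 2 ∧
    0 < Cj.E₂ ∧ 0 ≤ Cj.E₃ ∧ (1 : ℕ) ≤ 2 ∧
    (((2 * cth 32 1 2 + 1) ^ 1 : ℕ) : ℝ) * (5 : ℝ) ^ 1 * ((max 1 (2 * 32 + 2) : ℕ) : ℝ) ≤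
        ((Lj : ℕ) : ℝ) ^ (2 / 2) / 2 ∧
    (0 : ℝ) ≤ 3 / 4 ∧ (3 / 4 : ℝ) < 1 ∧ (1 / 2 : ℝ) ≤ (3 / 4) ^ 2 := by
  have hL : ((Lj : ℕ) : ℝ) = 87781 := by norm_num [Lj]
  refine ⟨by norm_num, ?_, ?_, by norm_num, by rw [hL]; norm_num, ?_, by norm_num, one_pos, by norm_num, ?_, by norm_num,
    by norm_num, by norm_num, ?_, by norm_num, by norm_num, by norm_num⟩
  · -- `log L + 2 log 2 ≤ L + 2` from `log x ≤ x − 1` and `log 2 < 1`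
    have h1 : Real.log (Lj : ℕ) ≤ (Lj : ℝ) - 1 := Real.log_le_sub_one_of_pos (by rw [hL]; norm_num)
    have h2 : Real.log 2 < 1 := by
      have := Real.log_two_lt_d9; linarith
    simp only [Cj_κ₁, Nat.cast_one, one_mul]
    linarith
  · -- `log (2 + birthMass) ≤ 1 + birthMass ≤ 2`
    have h1 : Real.log (2 + T4CanonicalMenus.birthMass Cj) ≤ 2 + T4CanonicalMenus.birthMass Cj - 1 :=
      Real.log_le_sub_one_of_pos (by linarith [birthMass_Cj_nonneg])
    simp only [Cj_E₀]
    linarith [birthMass_Cj_le_one]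
  · rw [hL]; norm_num [Lj]
  · norm_num [O₁]
  · rw [cth_32_1_2, hL]; norm_num

/-! ## §3 The RECORD's letter rows at the same constants -/

/-- **THE LETTER ROWS OF `HistReadDataLWL` (as consumed by leaf-05's `histReadDataLWL₄`), JOINTLY, AT THE SAME `(Cj, O₁)`**,
with `rr := 1`, record dimension `d := 1`, census letters `(p₁, η, η′, κ, κ₂, κᵥ) := (6, 3, 4, 6, 1, 8)`, and window letters
`cΛ = M = Lr = Φ := 0`, `b₀ := 1∕Lj` (the record's (2.7)∕(2.9) exponent letter, `= 1∕F.L`), `θv := 1∕8` — in the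
constructor's order: `hn₁ hE₂ hE₃ hp₀ hA₀ hγ₀ hA₁ hMO hβd hθv hcΛ hMΛ
hLr hΦ hβ₀ hexpR hexpR′ hexpB hexpFL hdq hexpVL hη hη′ hκ hκ₂ hκᵥ`. [decided arithmetic] -/
theorem joint_record_Cj :
    13 ≤ Cj.n₁ ∧ 0 < Cj.E₂ ∧ 0 < Cj.E₃ ∧ 1 ≤ Cj.p₀ ∧ 0 < Cj.A₀ ∧ 0 < O₁.γ₀ ∧ O₁.A₁ ≠ 0 ∧ 0 < O₁.M ∧
    O₁.β₀ * ((O₁.d : ℝ) + 2) ≤ 1 ∧ (0 : ℝ) < 1 / 8 ∧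
    (0 : ℝ) ≤ 0 ∧ (0 : ℝ) ≤ 0 ∧ (0 : ℝ) ≤ 0 ∧ (0 : ℝ) ≤ 0 ∧ (0 : ℝ) ≤ 1 / Lj ∧
    Cj.p₀ + 1 * (O₁.d + 3) + 3 = 2 * 6 ∧ 1 * (Cj.q' + 1) + 1 * (O₁.d + 3) + 4 = 2 * 6 ∧
    1 * (Cj.q' + 1) + 6 = 2 * Cj.p₀ ∧ 1 + 1 = 1 * (Cj.q' - 1) ∧ 1 ≤ Cj.q' ∧ 1 + 1 * 1 + 8 = 2 * Cj.p₀ ∧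
    (1 : ℕ) ≤ 3 ∧ (1 : ℕ) ≤ 4 ∧ (1 : ℕ) ≤ 6 ∧ (1 : ℕ) ≤ 1 ∧ (1 : ℕ) ≤ 8 := by
  refine ⟨by norm_num, by norm_num, by norm_num, by norm_num, by norm_num, by norm_num [O₁], by norm_num [O₁],
    by norm_num [O₁], by norm_num [O₁], by norm_num, le_rfl, le_rfl, le_rfl, le_rfl, by positivity, ?_, ?_, ?_, ?_, ?_, ?_,
    by norm_num, by norm_num, by norm_num, le_rfl, by norm_num⟩ <;> decide

/-- THE SAME CENSUS ROWS AT THE TERMINAL's GENERIC RECORD DIMENSION LETTER, instantiated at `d = 1` (the record's own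
`hexpFL : 1 + κ₂ = rr·(q′ − d)`, `hdq : d ≤ q′`, `hexpVL : 1 + rr·d + κᵥ = 2p₀`). [decided arithmetic] -/
theorem census_rows_Cj_d1 :
    1 + 1 = 1 * (Cj.q' - 1) ∧ 1 ≤ Cj.q' ∧ 1 + 1 * 1 + 8 = 2 * Cj.p₀ := by decide

/-! ## §4 The located negatives at the toy constants `C₄ = ⟨13, 0, 3, 1, 1, 0, 0, 0, 0, 0, 1, 3⟩` -/

/-- leaf-05's toy constants (`HistoryRealiseCellsRunAssemblyWTVSSanityLWL.C₄`, restated by value to keep this file's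
imports to the road of record). [decided arithmetic] -/
def C₄' : T4PrintedShapeBanking.Consts := ⟨13, 0, 3, 1, 1, 0, 0, 0, 0, 0, 1, 3⟩

/-- **THE TOY CONSTANTS FAIL `ThresholdOK`** at `rr = 1` (for every `L`, `β₀`): `rq_lt` would read `1·(3+1) < 3`.
[decided arithmetic] -/
theorem not_thresholdOK_C₄' (L : ℕ) (β₀ : ℝ) : ¬ ThresholdOK C₄' L 1 β₀ := by
  intro h
  have := h.rq_lt
  revert this
  decide

/-- **THE TOY CONSTANTS FAIL `0 < C.μ`** (`C₄.μ = 0`). [decided arithmetic] -/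
theorem not_mu_pos_C₄' : ¬ (0 < C₄'.μ) := by
  show ¬ ((0 : ℝ) < 0)
  exact lt_irrefl 0

/-- **THE TOY CONSTANTS FAIL `hκ₁`** for every `L ≥ 1` and every record dimension `d` (`C₄.κ₁ = 0 < 2·log 2`).
[decided arithmetic] -/
theorem not_hκ₁_C₄' (d L : ℕ) (hL : 1 ≤ L) : ¬ ((d : ℝ) * Real.log L + 2 * Real.log 2 ≤ C₄'.κ₁) := by
  intro h
  have h0 : (0 : ℝ) ≤ (d : ℝ) * Real.log L :=
    mul_nonneg (Nat.cast_nonneg d) (Real.log_nonneg (by exact_mod_cast hL))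
  have h2 : 0 < Real.log 2 := Real.log_pos (by norm_num)
  have : C₄'.κ₁ = 0 := rfl
  linarith

end

end Summit.QuantumFields.BalabanUV.T4Continuum.HistoryRealiseCellsRunAssemblyWTVSJointLetters
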